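/-
Copyright (c) 2026. All rights reserved.
Released under Apache 2.0 license as described in the file LICENSE.
Authors: HodgeCM publication cell (pub-hodgecm), model-construction sub-cell, construction prover `mc-theta-1`.
-/
import Literature.Analysis.SegalBargmann.SchwartzHeisenbergModel
import Literature.RepresentationTheory.HeisenbergGroup.SchrodingerSymplecticGenerators
import HarnessLib

/-!
# The Siegel-parabolic metaplectic generators on `𝓢(ℝ^σ)`: chirps and Levi dilations (Folland (4.24)–(4.25))

Topic `Analysis/SegalBargmann`; namespace `Literature.Analysis.SegalBargmann`. KERNEL throughout: no records, no
`sorry`, no hypotheses beyond the displayed ones.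

The archimedean Schrödinger model of this directory is `schwartzSchrodinger σ` (T12) on the Folland carrier
`𝓢((σ → ℝ), ℂ)` with Heisenberg operators `(ρ(p,q) f)(x) = e^{2πi q·x + πi p·q} f(x + p)` (T11 `rhoS`). This file
CONSTRUCTS the two explicit one-parameter-type families of the Siegel parabolic of `Sp(ℝ^σ ⊕ ℝ^σ)` as members of
weil-1's group of implementers `MpPsi (schwartzSchrodinger σ)`:

* §1–§2 **chirps** `chirpS b : f ↦ e^{-πi x·bx} f` for a linear `b : ℝ^σ →ₗ ℝ^σ` (Folland (4.25) with Folland's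
  sign), a continuous linear operator of `𝓢`, additive in `b` (`chirpS_add`, `chirpS_zero`), hence the automorphism
  `chirpEquiv b`;
* §3 for `b` SYMMETRIC, `chirpS b` implements weil-1's unipotent `unipotentSp (dotPairing σ) b : (p,q) ↦ (p, q + bp)`:
  `chirpS_rhoS : chirpS b (ρ(p,q) f) = ρ(p, q + bp) (chirpS b f)` and
  `chirp_mem_MpPsi : (unipotentSp _ b hb, chirpEquiv b) ∈ MpPsi (schwartzSchrodinger σ)`;
* §4 **Levi dilations** `leviS a d : f ↦ |det a|^{-1/2} f ∘ a⁻¹` for `a, d` with `a x · d y = x · y` (Folland (4.24)),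
  implementing weil-1's `leviSp (dotPairing σ) a d : (p,q) ↦ (ap, dq)`: `leviS_rhoS`, `levi_mem_MpPsi`, the group law
  `leviS_mul`, `leviS_one`;
* §5 the EXACT conjugation relation `leviS a d ∘ chirpS b ∘ (leviS a d)⁻¹ = chirpS (d ∘ b ∘ a⁻¹)` (`leviS_chirpS`) and
  its one-parameter reading — operator identities with NO scalar ambiguity, which is what pins relative characters of
  an abstract archimedean Weil datum on unipotent one-parameter subgroups (the `W2-∞-zp` node);
* §6 the unitary `L²` lift of the chirps: multiplication by a continuous unimodular function `mulUnitL2 u` is a linear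
  isometry equivalence of `L²(ℝ^σ)` and `toL2 (chirpS b f) = mulUnitL2 (chirpMul b) (toL2 f)` (`liftsTo_chirpS`), so the
  pair qualifies for T12's unitary rigidity `implements_eq_unitSmul_of_liftsTo`.

* §7 the unitary `L²` lift of the Levi dilations, `leviL2 a : g ↦ |det a|^{-1/2} g ∘ a⁻¹` (Jacobian
  `(a⁻¹)_* dx = |det a| dx`, Mathlib `Real.map_linearMap_volume_pi_eq_smul_volume_pi`), `toL2 (leviS a f) = leviL2 a (toL2 f)`
  (`liftsTo_leviS`).

The Fourier / opposite-unipotent generator is the business of the sequel file.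

References: [Folland1989] G. B. Folland, Harmonic Analysis in Phase Space, Ch. 4 §2, (4.24)–(4.26), Prop. (4.27);
[Weil1964] A. Weil, Sur certains groupes d'opérateurs unitaires, n° 6, 13; [MoeglinVignerasWaldspurger1987] Chap. 2 II.1–II.6.
-/

set_option autoImplicit false

noncomputable section

open MeasureTheory Complex Real
open scoped ComplexConjugate FourierTransform ENNReal

namespace Literature.Analysis.SegalBargmann

open Literature.RepresentationTheory.HeisenbergGroup

/-- `L²(ℝ^σ)`. -/
local notation "L2R" σ:max => (Lp ℂ 2 (volume : Measure (σ → ℝ)))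
/-- Folland's Schwartz space `𝓢(ℝ^σ)` on the sup-norm carrier. -/
local notation "SR" σ:max => (SchwartzMap (σ → ℝ) ℂ)

variable {σ : Type*} [Fintype σ] [DecidableEq σ]

/-! ## 1. The quadratic phase `e^{-πi x·bx}` -/

/-- The real quadratic exponent `-π x·(b x)`. [cite: Folland1989, (4.25)] -/
def chirpArg (b : (σ → ℝ) →ₗ[ℝ] (σ → ℝ)) (x : σ → ℝ) : ℝ := -(π * (x ⬝ᵥ b x))

/-- **Folland's chirp multiplier** `x ↦ e^{-πi x·bx}`. [cite: Folland1989, (4.25)] -/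
def chirpMul (b : (σ → ℝ) →ₗ[ℝ] (σ → ℝ)) (x : σ → ℝ) : ℂ := cexp ((chirpArg b x : ℂ) * I)

omit [DecidableEq σ] in
/-- `|e^{-πi x·bx}| = 1`. [folklore] -/
@[simp] theorem norm_chirpMul (b : (σ → ℝ) →ₗ[ℝ] (σ → ℝ)) (x : σ → ℝ) : ‖chirpMul b x‖ = 1 := by
  rw [chirpMul, Complex.norm_exp_ofReal_mul_I]

omit [DecidableEq σ] in
/-- `e^{-πi x·bx} ≠ 0`. [folklore] -/
theorem chirpMul_ne_zero (b : (σ → ℝ) →ₗ[ℝ] (σ → ℝ)) (x : σ → ℝ) : chirpMul b x ≠ 0 := Complex.exp_ne_zero _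

omit [DecidableEq σ] in
/-- The quadratic form `x ↦ x·bx` has temperate growth (a finite sum of products of coordinates). [folklore] -/
theorem hasTemperateGrowth_quadForm (b : (σ → ℝ) →ₗ[ℝ] (σ → ℝ)) :
    (fun x : σ → ℝ => x ⬝ᵥ b x).HasTemperateGrowth := by
  have h : (fun x : σ → ℝ => x ⬝ᵥ b x) = fun x => ∑ k ∈ Finset.univ, (fun (k : σ) (x : σ → ℝ) => x k * b x k) k x := by
    funext x
    rfl
  rw [h]
  refine Function.HasTemperateGrowth.sum fun k _ => ?_
  have h1 : (fun x : σ → ℝ => x k).HasTemperateGrowth :=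
    (ContinuousLinearMap.proj (R := ℝ) (φ := fun _ : σ => ℝ) k).hasTemperateGrowth
  have h2 : (fun x : σ → ℝ => b x k).HasTemperateGrowth :=
    ((ContinuousLinearMap.proj (R := ℝ) (φ := fun _ : σ => ℝ) k).comp (LinearMap.toContinuousLinearMap b)).hasTemperateGrowth
  exact h1.mul h2

omit [DecidableEq σ] in
/-- The exponent `-π x·bx` has temperate growth. [folklore] -/
theorem hasTemperateGrowth_chirpArg (b : (σ → ℝ) →ₗ[ℝ] (σ → ℝ)) : (chirpArg b).HasTemperateGrowth := by
  have h : chirpArg b = fun x => -π * (x ⬝ᵥ b x) := by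
    funext x
    rw [chirpArg, neg_mul]
  rw [h]
  exact (Function.HasTemperateGrowth.const _).mul (hasTemperateGrowth_quadForm b)

omit [DecidableEq σ] in
/-- **The chirp multiplier has temperate growth**, so it acts on Schwartz space. [folklore] -/
theorem hasTemperateGrowth_chirpMul (b : (σ → ℝ) →ₗ[ℝ] (σ → ℝ)) : (chirpMul b).HasTemperateGrowth := by
  have h : chirpMul b = (fun s : ℝ => cexp ((s : ℂ) * I)) ∘ chirpArg b := rfl
  rw [h]
  exact Literature.Analysis.Fourier.hasTemperateGrowth_cexp_ofReal_mul_I.comp (hasTemperateGrowth_chirpArg b)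

omit [DecidableEq σ] in
/-- The multiplier is continuous. [folklore] -/
theorem continuous_chirpMul (b : (σ → ℝ) →ₗ[ℝ] (σ → ℝ)) : Continuous (chirpMul b) := by
  unfold chirpMul chirpArg
  fun_prop

omit [DecidableEq σ] in
/-- Additivity in `b`: `e^{-πi x·(b+b')x} = e^{-πi x·bx} e^{-πi x·b'x}`. [folklore] -/
theorem chirpMul_add (b b' : (σ → ℝ) →ₗ[ℝ] (σ → ℝ)) (x : σ → ℝ) :
    chirpMul (b + b') x = chirpMul b x * chirpMul b' x := by
  rw [chirpMul, chirpMul, chirpMul, ← Complex.exp_add, ← add_mul, ← Complex.ofReal_add]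
  congr 3
  rw [chirpArg, chirpArg, chirpArg, LinearMap.add_apply, dotProduct_add]
  ring

omit [DecidableEq σ] in
/-- `e^{-πi x·0x} = 1`. [folklore] -/
@[simp] theorem chirpMul_zero (x : σ → ℝ) : chirpMul (0 : (σ → ℝ) →ₗ[ℝ] (σ → ℝ)) x = 1 := by
  rw [chirpMul, chirpArg, LinearMap.zero_apply, dotProduct_zero, mul_zero, neg_zero, Complex.ofReal_zero, zero_mul,
    Complex.exp_zero]

omit [DecidableEq σ] in
/-- `e^{-πi x·(-b)x} e^{-πi x·bx} = 1`. [folklore] -/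
theorem chirpMul_neg_mul (b : (σ → ℝ) →ₗ[ℝ] (σ → ℝ)) (x : σ → ℝ) : chirpMul (-b) x * chirpMul b x = 1 := by
  rw [← chirpMul_add, neg_add_cancel, chirpMul_zero]

/-! ## 2. The chirp operators on `𝓢(ℝ^σ)` -/

/-- **The chirp `f ↦ e^{-πi x·bx} f` on Schwartz space** (Folland (4.25) restricted to `𝓢`), a continuous linear
operator. [cite: Folland1989, (4.25)] -/
def chirpS (b : (σ → ℝ) →ₗ[ℝ] (σ → ℝ)) : (SR σ) →L[ℂ] SR σ := SchwartzMap.smulLeftCLM ℂ (chirpMul b)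

omit [DecidableEq σ] in
/-- Pointwise formula. [cite: Folland1989, (4.25)] -/
@[simp] theorem chirpS_apply (b : (σ → ℝ) →ₗ[ℝ] (σ → ℝ)) (f : SR σ) (x : σ → ℝ) :
    chirpS b f x = chirpMul b x * f x := by
  rw [chirpS, SchwartzMap.smulLeftCLM_apply_apply (hasTemperateGrowth_chirpMul b), smul_eq_mul]

omit [DecidableEq σ] in
/-- **Additivity**: `chirpS (b + b') = chirpS b ∘ chirpS b'` (a homomorphism from `(End ℝ^σ, +)`). [folklore] -/
theorem chirpS_add (b b' : (σ → ℝ) →ₗ[ℝ] (σ → ℝ)) : chirpS (b + b') = (chirpS b).comp (chirpS b') := by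
  ext f x
  rw [ContinuousLinearMap.comp_apply, chirpS_apply, chirpS_apply, chirpS_apply, chirpMul_add, mul_assoc]

omit [DecidableEq σ] in
/-- `chirpS 0 = id`. [folklore] -/
@[simp] theorem chirpS_zero : chirpS (0 : (σ → ℝ) →ₗ[ℝ] (σ → ℝ)) = ContinuousLinearMap.id ℂ (SR σ) := by
  ext f x
  rw [chirpS_apply, chirpMul_zero, one_mul, ContinuousLinearMap.id_apply]

omit [DecidableEq σ] in
/-- `chirpS (-b) ∘ chirpS b = id`. [folklore] -/
theorem chirpS_neg_comp (b : (σ → ℝ) →ₗ[ℝ] (σ → ℝ)) :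
    (chirpS (-b)).comp (chirpS b) = ContinuousLinearMap.id ℂ (SR σ) := by
  rw [← chirpS_add, neg_add_cancel, chirpS_zero]

omit [DecidableEq σ] in
/-- `chirpS b ∘ chirpS (-b) = id`. [folklore] -/
theorem chirpS_comp_neg (b : (σ → ℝ) →ₗ[ℝ] (σ → ℝ)) :
    (chirpS b).comp (chirpS (-b)) = ContinuousLinearMap.id ℂ (SR σ) := by
  rw [← chirpS_add, add_neg_cancel, chirpS_zero]

/-- **The chirp as an automorphism of `𝓢(ℝ^σ)`**, inverse `chirpS (-b)`. [cite: Folland1989, (4.25)] -/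
def chirpEquiv (b : (σ → ℝ) →ₗ[ℝ] (σ → ℝ)) : (SR σ) ≃L[ℂ] SR σ :=
  ContinuousLinearEquiv.equivOfInverse (chirpS b) (chirpS (-b))
    (fun f => by rw [← ContinuousLinearMap.comp_apply, chirpS_neg_comp, ContinuousLinearMap.id_apply])
    (fun f => by rw [← ContinuousLinearMap.comp_apply, chirpS_comp_neg, ContinuousLinearMap.id_apply])

omit [DecidableEq σ] in
/-- Unfolding. [folklore] -/
@[simp] theorem chirpEquiv_apply (b : (σ → ℝ) →ₗ[ℝ] (σ → ℝ)) (f : SR σ) : chirpEquiv b f = chirpS b f := rfl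

omit [DecidableEq σ] in
/-- The underlying linear map of `chirpEquiv b` is `chirpS b`. [folklore] -/
theorem coe_chirpEquiv (b : (σ → ℝ) →ₗ[ℝ] (σ → ℝ)) :
    ((chirpEquiv b : (SR σ) ≃ₗ[ℂ] SR σ) : (SR σ) →ₗ[ℂ] SR σ) = (chirpS b : (SR σ) →ₗ[ℂ] SR σ) :=
  LinearMap.ext fun _ => rfl

omit [DecidableEq σ] in
/-- The one-parameter chirp group `y ↦ chirpS (y • b)` is additive. [cite: Folland1989, (4.25)] -/
theorem chirpS_smul_add (b : (σ → ℝ) →ₗ[ℝ] (σ → ℝ)) (y y' : ℝ) :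
    chirpS ((y + y') • b) = (chirpS (y • b)).comp (chirpS (y' • b)) := by
  rw [add_smul, chirpS_add]

/-! ## 3. Chirps implement the unipotent radical of the Siegel parabolic -/

omit [DecidableEq σ] in
/-- The phase bookkeeping behind `chirpS_rhoS`: for symmetric `b`,
`e^{-πi x·bx} e^{2πi q·x + πi p·q} = e^{2πi (q+bp)·x + πi p·(q+bp)} e^{-πi (x+p)·b(x+p)}`. [cite: Folland1989, (4.25)] -/
theorem chirpMul_mul_rhoMul {b : (σ → ℝ) →ₗ[ℝ] (σ → ℝ)} (hb : ∀ x x' : σ → ℝ, x ⬝ᵥ b x' = x' ⬝ᵥ b x)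
    (p q x : σ → ℝ) : chirpMul b x * rhoMul p q x = rhoMul p (q + b p) x * chirpMul b (x + p) := by
  rw [chirpMul, chirpMul, rhoMul, rhoMul, ← Complex.exp_add, ← Complex.exp_add, ← add_mul, ← add_mul,
    ← Complex.ofReal_add, ← Complex.ofReal_add]
  congr 3
  have h1 : ∑ k, (q + b p) k * x k = ∑ k, q k * x k + x ⬝ᵥ b p := by
    simp only [Pi.add_apply, add_mul, Finset.sum_add_distrib, dotProduct]
    congr 1
    exact Finset.sum_congr rfl fun k _ => mul_comm _ _
  have h2 : ∑ k, p k * (q + b p) k = ∑ k, p k * q k + p ⬝ᵥ b p := by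
    simp only [Pi.add_apply, mul_add, Finset.sum_add_distrib, dotProduct]
  have h3 : (x + p) ⬝ᵥ b (x + p) = x ⬝ᵥ b x + 2 * (x ⬝ᵥ b p) + p ⬝ᵥ b p := by
    rw [map_add, add_dotProduct, dotProduct_add, dotProduct_add, hb p x]
    ring
  rw [chirpArg, chirpArg, h1, h2, h3]
  ring

omit [DecidableEq σ] in
/-- **Chirps implement `n(b)`**: for symmetric `b`, `chirpS b (ρ(p,q) f) = ρ(p, q + bp) (chirpS b f)` — MVW's condition (A)
for weil-1's `unipotentSp (dotPairing σ) b`, in Folland's coordinates. [cite: Folland1989, (4.25); MoeglinVignerasWaldspurger1987, Chap. 2 II.6] -/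
theorem chirpS_rhoS {b : (σ → ℝ) →ₗ[ℝ] (σ → ℝ)} (hb : ∀ x x' : σ → ℝ, x ⬝ᵥ b x' = x' ⬝ᵥ b x)
    (p q : σ → ℝ) (f : SR σ) : chirpS b (rhoS p q f) = rhoS p (q + b p) (chirpS b f) := by
  ext x
  rw [chirpS_apply, rhoS_apply, rhoS_apply, chirpS_apply, ← mul_assoc, chirpMul_mul_rhoMul hb, mul_assoc]

omit [DecidableEq σ] in
/-- Symmetry of `b` in weil-1's form `β x (b x') = β x' (b x)` for `β = dotPairing σ`. [folklore] -/
theorem dotPairing_symm_iff (b : (σ → ℝ) →ₗ[ℝ] (σ → ℝ)) :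
    (∀ x x' : σ → ℝ, dotPairing σ x (b x') = dotPairing σ x' (b x)) ↔ ∀ x x' : σ → ℝ, x ⬝ᵥ b x' = x' ⬝ᵥ b x := by
  simp only [dotPairing_apply]

omit [DecidableEq σ] in
/-- **`(n(b), chirpEquiv b) ∈ MpPsi (schwartzSchrodinger σ)`**: the chirp is a member of weil-1's group of implementers
over the unipotent element of the Siegel parabolic. [cite: Folland1989, (4.25); MoeglinVignerasWaldspurger1987, Chap. 2 II.1 (A), II.6] -/
theorem chirp_mem_MpPsi {b : (σ → ℝ) →ₗ[ℝ] (σ → ℝ)} (hb : ∀ x x' : σ → ℝ, dotPairing σ x (b x') = dotPairing σ x' (b x)) :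
    (unipotentSp (dotPairing σ) b hb, (chirpEquiv b : (SR σ) ≃ₗ[ℂ] SR σ)) ∈ MpPsi (schwartzSchrodinger σ) := by
  rw [mem_MpPsi_iff]
  intro p q f
  have hb' : ∀ x x' : σ → ℝ, x ⬝ᵥ b x' = x' ⬝ᵥ b x := (dotPairing_symm_iff b).1 hb
  show chirpS b (rhoS p q f) = _
  rw [coe_unipotentSp, unipotentσ_apply]
  exact chirpS_rhoS hb' p q f

omit [DecidableEq σ] in
/-- Family form: the chirp family over any parametrisation `h ↦ b h` of symmetric maps is `IsPhaseCovariantS` over the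
unipotent phase-space action `(p,q) ↦ (p, q + b h p)`. [cite: MoeglinVignerasWaldspurger1987, Chap. 2 II.1 (A)] -/
theorem isPhaseCovariantS_chirpS {H : Type*} (b : H → ((σ → ℝ) →ₗ[ℝ] (σ → ℝ)))
    (hb : ∀ h (x x' : σ → ℝ), x ⬝ᵥ b h x' = x' ⬝ᵥ b h x) :
    IsPhaseCovariantS (fun h (pq : (σ → ℝ) × (σ → ℝ)) => (pq.1, pq.2 + b h pq.1))
      (fun h => (chirpS (b h) : (SR σ) →ₗ[ℂ] SR σ)) :=
  fun h p q f => chirpS_rhoS (hb h) p q f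

/-! ## 4. Levi dilations -/

section Levi

/-- The normalising factor `|det a|^{-1/2}` (as a complex scalar). [cite: Folland1989, (4.24)] -/
def leviFactor (a : (σ → ℝ) ≃ₗ[ℝ] (σ → ℝ)) : ℂ :=
  ((|LinearMap.det (a : (σ → ℝ) →ₗ[ℝ] (σ → ℝ))| ^ (-(1 / 2 : ℝ)) : ℝ) : ℂ)

omit [Fintype σ] [DecidableEq σ] in
/-- `|det a|^{-1/2} ≠ 0`. [folklore] -/
theorem leviFactor_ne_zero (a : (σ → ℝ) ≃ₗ[ℝ] (σ → ℝ)) : leviFactor a ≠ 0 := by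
  rw [leviFactor, Complex.ofReal_ne_zero]
  exact (Real.rpow_pos_of_pos (abs_pos.2 (LinearEquiv.isUnit_det' a).ne_zero) _).ne'

omit [Fintype σ] [DecidableEq σ] in
/-- `|det 1|^{-1/2} = 1`. [folklore] -/
@[simp] theorem leviFactor_one : leviFactor (1 : (σ → ℝ) ≃ₗ[ℝ] (σ → ℝ)) = 1 := by
  rw [leviFactor]
  have : LinearMap.det ((1 : (σ → ℝ) ≃ₗ[ℝ] (σ → ℝ)) : (σ → ℝ) →ₗ[ℝ] (σ → ℝ)) = 1 := LinearMap.det_id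
  rw [this, abs_one, Real.one_rpow, Complex.ofReal_one]

omit [Fintype σ] [DecidableEq σ] in
/-- Multiplicativity `|det (a a')|^{-1/2} = |det a|^{-1/2} |det a'|^{-1/2}`. [folklore] -/
theorem leviFactor_mul (a a' : (σ → ℝ) ≃ₗ[ℝ] (σ → ℝ)) : leviFactor (a * a') = leviFactor a * leviFactor a' := by
  rw [leviFactor, leviFactor, leviFactor, ← Complex.ofReal_mul]
  congr 1
  have h : LinearMap.det ((a * a' : (σ → ℝ) ≃ₗ[ℝ] (σ → ℝ)) : (σ → ℝ) →ₗ[ℝ] (σ → ℝ)) =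
      LinearMap.det (a : (σ → ℝ) →ₗ[ℝ] (σ → ℝ)) * LinearMap.det (a' : (σ → ℝ) →ₗ[ℝ] (σ → ℝ)) := by
    rw [← LinearMap.det_comp]
    rfl
  rw [h, abs_mul, Real.mul_rpow (abs_nonneg _) (abs_nonneg _)]

/-- **The Levi dilation `f ↦ |det a|^{-1/2} f ∘ a⁻¹` on Schwartz space** (Folland (4.24) restricted to `𝓢`; the
finite-dimensional linear equivalence `a⁻¹` is upgraded to a continuous one). [cite: Folland1989, (4.24)] -/
def leviS (a : (σ → ℝ) ≃ₗ[ℝ] (σ → ℝ)) : (SR σ) →L[ℂ] SR σ :=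
  leviFactor a • SchwartzMap.compCLMOfContinuousLinearEquiv ℂ (a.symm.toContinuousLinearEquiv)

omit [DecidableEq σ] in
/-- Pointwise formula `(leviS a f)(x) = |det a|^{-1/2} f (a⁻¹ x)`. [cite: Folland1989, (4.24)] -/
@[simp] theorem leviS_apply (a : (σ → ℝ) ≃ₗ[ℝ] (σ → ℝ)) (f : SR σ) (x : σ → ℝ) :
    leviS a f x = leviFactor a * f (a.symm x) := rfl

omit [DecidableEq σ] in
/-- **Group law** `leviS (a a') = leviS a ∘ leviS a'`. [folklore] -/
theorem leviS_mul (a a' : (σ → ℝ) ≃ₗ[ℝ] (σ → ℝ)) : leviS (a * a') = (leviS a).comp (leviS a') := by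
  ext f x
  rw [ContinuousLinearMap.comp_apply, leviS_apply, leviS_apply, leviS_apply, leviFactor_mul, mul_assoc]
  rfl

omit [DecidableEq σ] in
/-- `leviS 1 = id`. [folklore] -/
@[simp] theorem leviS_one : leviS (1 : (σ → ℝ) ≃ₗ[ℝ] (σ → ℝ)) = ContinuousLinearMap.id ℂ (SR σ) := by
  ext f x
  rw [leviS_apply, leviFactor_one, one_mul, ContinuousLinearMap.id_apply]
  rfl

/-- **The Levi dilation as an automorphism of `𝓢(ℝ^σ)`**, inverse `leviS a⁻¹`. [cite: Folland1989, (4.24)] -/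
def leviEquiv (a : (σ → ℝ) ≃ₗ[ℝ] (σ → ℝ)) : (SR σ) ≃L[ℂ] SR σ :=
  ContinuousLinearEquiv.equivOfInverse (leviS a) (leviS a⁻¹)
    (fun f => by rw [← ContinuousLinearMap.comp_apply, ← leviS_mul, inv_mul_cancel, leviS_one, ContinuousLinearMap.id_apply])
    (fun f => by rw [← ContinuousLinearMap.comp_apply, ← leviS_mul, mul_inv_cancel, leviS_one, ContinuousLinearMap.id_apply])

omit [DecidableEq σ] in
/-- Unfolding. [folklore] -/
@[simp] theorem leviEquiv_apply (a : (σ → ℝ) ≃ₗ[ℝ] (σ → ℝ)) (f : SR σ) : leviEquiv a f = leviS a f := rfl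

omit [DecidableEq σ] in
/-- The phase bookkeeping behind `leviS_rhoS`: if `a x · d y = x · y` then
`e^{2πi q·(a⁻¹x) + πi p·q} = e^{2πi (dq)·x + πi (ap)·(dq)}`. [cite: Folland1989, (4.24)] -/
theorem rhoMul_levi {a d : (σ → ℝ) ≃ₗ[ℝ] (σ → ℝ)} (had : ∀ x y : σ → ℝ, a x ⬝ᵥ d y = x ⬝ᵥ y) (p q x : σ → ℝ) :
    rhoMul p q (a.symm x) = rhoMul (a p) (d q) x := by
  rw [rhoMul, rhoMul]
  congr 3
  have h1 : ∑ k, q k * (a.symm x) k = ∑ k, d q k * x k := by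
    have h := had (a.symm x) q
    rw [LinearEquiv.apply_symm_apply] at h
    have h' : ∑ k, q k * (a.symm x) k = a.symm x ⬝ᵥ q := by
      rw [dotProduct]; exact Finset.sum_congr rfl fun k _ => mul_comm _ _
    rw [h', ← h, dotProduct]
    exact Finset.sum_congr rfl fun k _ => mul_comm _ _
  have h2 : ∑ k, p k * q k = ∑ k, a p k * d q k := by
    have h := had p q
    rw [dotProduct, dotProduct] at h
    exact h.symm
  rw [h1, h2]

omit [DecidableEq σ] in
/-- **Levi dilations implement `m(a,d)`**: `leviS a (ρ(p,q) f) = ρ(ap, dq) (leviS a f)` whenever `a x · d y = x · y`.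
[cite: Folland1989, (4.24); MoeglinVignerasWaldspurger1987, Chap. 2 II.6] -/
theorem leviS_rhoS {a d : (σ → ℝ) ≃ₗ[ℝ] (σ → ℝ)} (had : ∀ x y : σ → ℝ, a x ⬝ᵥ d y = x ⬝ᵥ y)
    (p q : σ → ℝ) (f : SR σ) : leviS a (rhoS p q f) = rhoS (a p) (d q) (leviS a f) := by
  ext x
  rw [leviS_apply, rhoS_apply, rhoS_apply, leviS_apply, rhoMul_levi had, a.symm.map_add, LinearEquiv.symm_apply_apply,
    mul_left_comm]

omit [DecidableEq σ] in
/-- **`(m(a,d), leviEquiv a) ∈ MpPsi (schwartzSchrodinger σ)`**. [cite: Folland1989, (4.24); MoeglinVignerasWaldspurger1987, Chap. 2 II.1 (A), II.6] -/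
theorem levi_mem_MpPsi {a d : (σ → ℝ) ≃ₗ[ℝ] (σ → ℝ)} (had : ∀ x y : σ → ℝ, dotPairing σ (a x) (d y) = dotPairing σ x y) :
    (leviSp (dotPairing σ) a d had, (leviEquiv a : (SR σ) ≃ₗ[ℂ] SR σ)) ∈ MpPsi (schwartzSchrodinger σ) := by
  rw [mem_MpPsi_iff]
  intro p q f
  have had' : ∀ x y : σ → ℝ, a x ⬝ᵥ d y = x ⬝ᵥ y := fun x y => by simpa only [dotPairing_apply] using had x y
  show leviS a (rhoS p q f) = _
  rw [coe_leviSp_apply]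
  exact leviS_rhoS had' p q f

/-! ## 5. The exact conjugation relation `m(a,d) n(b) m(a,d)⁻¹ = n(d b a⁻¹)` on operators -/

omit [DecidableEq σ] in
/-- **`leviS a ∘ chirpS b = chirpS (d ∘ b ∘ a⁻¹) ∘ leviS a`** whenever `a x · d y = x · y` — an identity of operators on
`𝓢(ℝ^σ)` with no scalar: conjugating a chirp by a Levi dilation is the chirp of the conjugated symmetric map.
[cite: Folland1989, (4.24)–(4.25)] -/
theorem leviS_chirpS {a d : (σ → ℝ) ≃ₗ[ℝ] (σ → ℝ)} (had : ∀ x y : σ → ℝ, a x ⬝ᵥ d y = x ⬝ᵥ y)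
    (b : (σ → ℝ) →ₗ[ℝ] (σ → ℝ)) :
    (leviS a).comp (chirpS b) =
      (chirpS ((d : (σ → ℝ) →ₗ[ℝ] (σ → ℝ)) ∘ₗ b ∘ₗ (a.symm : (σ → ℝ) →ₗ[ℝ] (σ → ℝ)))).comp (leviS a) := by
  ext f x
  rw [ContinuousLinearMap.comp_apply, ContinuousLinearMap.comp_apply, leviS_apply, chirpS_apply, chirpS_apply,
    leviS_apply, mul_left_comm]
  congr 1
  rw [chirpMul, chirpMul, chirpArg, chirpArg]
  congr 4
  have h := had (a.symm x) (b (a.symm x))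
  rw [LinearEquiv.apply_symm_apply] at h
  rw [← h]
  rfl

omit [DecidableEq σ] in
/-- One-parameter reading: if conjugation by `m(a,d)` rescales the line `ℝ b` by `c`, `d ∘ b ∘ a⁻¹ = c • b`, then
`leviS a ∘ chirpS (y • b) = chirpS ((c * y) • b) ∘ leviS a` for every `y`. [cite: Folland1989, (4.24)–(4.25)] -/
theorem leviS_chirpS_smul {a d : (σ → ℝ) ≃ₗ[ℝ] (σ → ℝ)} (had : ∀ x y : σ → ℝ, a x ⬝ᵥ d y = x ⬝ᵥ y)
    {b : (σ → ℝ) →ₗ[ℝ] (σ → ℝ)} {c : ℝ}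
    (hc : (d : (σ → ℝ) →ₗ[ℝ] (σ → ℝ)) ∘ₗ b ∘ₗ (a.symm : (σ → ℝ) →ₗ[ℝ] (σ → ℝ)) = c • b) (y : ℝ) :
    (leviS a).comp (chirpS (y • b)) = (chirpS ((c * y) • b)).comp (leviS a) := by
  rw [leviS_chirpS had, LinearMap.smul_comp, LinearMap.comp_smul, hc, smul_smul, mul_comm y c]

/-! ## 6. The unitary `L²` lift of the chirps -/

omit [DecidableEq σ] in
/-- `u · g ∈ L²` for `g ∈ L²` and `u` continuous unimodular. [folklore] -/
theorem memLp_unit_mul {u : (σ → ℝ) → ℂ} (hu : Continuous u) (h1 : ∀ x, ‖u x‖ = 1) (g : L2R σ) :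
    MemLp (fun x => u x * g x) 2 (volume : Measure (σ → ℝ)) :=
  (Lp.memLp g).of_le (hu.aestronglyMeasurable.mul (Lp.aestronglyMeasurable g))
    (Filter.Eventually.of_forall fun x => by rw [norm_mul, h1, one_mul])

/-- Multiplication by a continuous unimodular `u` as a linear map of `L²(ℝ^σ)`. [folklore] -/
def mulUnitₗ {u : (σ → ℝ) → ℂ} (hu : Continuous u) (h1 : ∀ x, ‖u x‖ = 1) : (L2R σ) →ₗ[ℂ] L2R σ where
  toFun g := (memLp_unit_mul hu h1 g).toLp _
  map_add' g g' := by
    rw [← MemLp.toLp_add (memLp_unit_mul hu h1 g) (memLp_unit_mul hu h1 g')]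
    refine MemLp.toLp_congr _ _ ?_
    filter_upwards [Lp.coeFn_add g g'] with x hx
    rw [hx, Pi.add_apply, Pi.add_apply, mul_add]
  map_smul' c g := by
    rw [RingHom.id_apply, ← MemLp.toLp_const_smul c (memLp_unit_mul hu h1 g)]
    refine MemLp.toLp_congr _ _ ?_
    filter_upwards [Lp.coeFn_smul c g] with x hx
    rw [hx, Pi.smul_apply, Pi.smul_apply, smul_eq_mul, smul_eq_mul, mul_left_comm]

omit [DecidableEq σ] in
/-- `(mulUnitₗ u g)(x) = u x · g x` a.e. [folklore] -/
theorem mulUnitₗ_coeFn {u : (σ → ℝ) → ℂ} (hu : Continuous u) (h1 : ∀ x, ‖u x‖ = 1) (g : L2R σ) :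
    ⇑(mulUnitₗ hu h1 g) =ᵐ[volume] fun x => u x * g x :=
  MemLp.coeFn_toLp (memLp_unit_mul hu h1 g)

omit [DecidableEq σ] in
/-- Multiplication by a unimodular function preserves the `L²` norm. [folklore] -/
theorem norm_mulUnitₗ {u : (σ → ℝ) → ℂ} (hu : Continuous u) (h1 : ∀ x, ‖u x‖ = 1) (g : L2R σ) :
    ‖mulUnitₗ hu h1 g‖ = ‖g‖ := by
  have h : ∀ᵐ x ∂(volume : Measure (σ → ℝ)), ‖(mulUnitₗ hu h1 g) x‖ = ‖g x‖ :=
    (mulUnitₗ_coeFn hu h1 g).mono fun x hx => by rw [hx, norm_mul, h1, one_mul]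
  rw [Lp.norm_def, Lp.norm_def, eLpNorm_congr_norm_ae h]

omit [DecidableEq σ] in
/-- The inverse multiplier `ū = u⁻¹` is continuous and unimodular and cancels `u`. [folklore] -/
theorem mulUnitₗ_conj_mulUnitₗ {u : (σ → ℝ) → ℂ} (hu : Continuous u) (h1 : ∀ x, ‖u x‖ = 1) (g : L2R σ) :
    mulUnitₗ (u := fun x => conj (u x)) (Complex.continuous_conj.comp hu) (fun x => by rw [RCLike.norm_conj, h1])
      (mulUnitₗ hu h1 g) = g := by
  refine Lp.ext ?_
  filter_upwards [mulUnitₗ_coeFn (u := fun x => conj (u x)) (Complex.continuous_conj.comp hu)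
    (fun x => by rw [RCLike.norm_conj, h1]) (mulUnitₗ hu h1 g), mulUnitₗ_coeFn hu h1 g] with x hx hx'
  rw [hx, hx', ← mul_assoc, ← Complex.normSq_eq_conj_mul_self, Complex.normSq_eq_norm_sq, h1, one_pow,
    Complex.ofReal_one, one_mul]

omit [DecidableEq σ] in
/-- … and in the other order. [folklore] -/
theorem mulUnitₗ_mulUnitₗ_conj {u : (σ → ℝ) → ℂ} (hu : Continuous u) (h1 : ∀ x, ‖u x‖ = 1) (g : L2R σ) :
    mulUnitₗ hu h1 (mulUnitₗ (u := fun x => conj (u x)) (Complex.continuous_conj.comp hu)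
      (fun x => by rw [RCLike.norm_conj, h1]) g) = g := by
  refine Lp.ext ?_
  filter_upwards [mulUnitₗ_coeFn hu h1 (mulUnitₗ (u := fun x => conj (u x)) (Complex.continuous_conj.comp hu)
    (fun x => by rw [RCLike.norm_conj, h1]) g), mulUnitₗ_coeFn (u := fun x => conj (u x))
    (Complex.continuous_conj.comp hu) (fun x => by rw [RCLike.norm_conj, h1]) g] with x hx hx'
  rw [hx, hx', ← mul_assoc, Complex.mul_conj, Complex.normSq_eq_norm_sq, h1, one_pow, Complex.ofReal_one, one_mul]

/-- **Multiplication by a continuous unimodular function is a unitary of `L²(ℝ^σ)`.** [folklore] -/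
def mulUnitL2 {u : (σ → ℝ) → ℂ} (hu : Continuous u) (h1 : ∀ x, ‖u x‖ = 1) : (L2R σ) ≃ₗᵢ[ℂ] L2R σ where
  toLinearEquiv :=
    LinearEquiv.ofLinear (mulUnitₗ hu h1)
      (mulUnitₗ (u := fun x => conj (u x)) (Complex.continuous_conj.comp hu) (fun x => by rw [RCLike.norm_conj, h1]))
      (LinearMap.ext fun g => mulUnitₗ_mulUnitₗ_conj hu h1 g)
      (LinearMap.ext fun g => mulUnitₗ_conj_mulUnitₗ hu h1 g)
  norm_map' := norm_mulUnitₗ hu h1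

omit [DecidableEq σ] in
/-- Unfolding. [folklore] -/
@[simp] theorem mulUnitL2_apply {u : (σ → ℝ) → ℂ} (hu : Continuous u) (h1 : ∀ x, ‖u x‖ = 1) (g : L2R σ) :
    mulUnitL2 hu h1 g = mulUnitₗ hu h1 g := rfl

omit [DecidableEq σ] in
/-- `(mulUnitL2 u g)(x) = u x · g x` a.e. [folklore] -/
theorem mulUnitL2_coeFn {u : (σ → ℝ) → ℂ} (hu : Continuous u) (h1 : ∀ x, ‖u x‖ = 1) (g : L2R σ) :
    ⇑(mulUnitL2 hu h1 g) =ᵐ[volume] fun x => u x * g x :=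
  mulUnitₗ_coeFn hu h1 g

/-- **The unitary chirp** `f ↦ e^{-πi x·bx} f` of `L²(ℝ^σ)` (Folland (4.25)). [cite: Folland1989, (4.25)] -/
def chirpL2 (b : (σ → ℝ) →ₗ[ℝ] (σ → ℝ)) : (L2R σ) ≃ₗᵢ[ℂ] L2R σ :=
  mulUnitL2 (continuous_chirpMul b) (norm_chirpMul b)

omit [DecidableEq σ] in
/-- **The Schwartz chirp is the `L²` chirp on the dense subspace**: `toL2 (chirpS b f) = chirpL2 b (toL2 f)`.
[cite: Folland1989, (4.25)] -/
theorem toL2_chirpS (b : (σ → ℝ) →ₗ[ℝ] (σ → ℝ)) (f : SR σ) : toL2 (chirpS b f) = chirpL2 b (toL2 f) := by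
  apply Lp.ext
  have h1 := coeFn_toL2 (chirpS b f)
  have h2 := mulUnitL2_coeFn (continuous_chirpMul b) (norm_chirpMul b) (toL2 f)
  have h3 := coeFn_toL2 f
  rw [chirpL2]
  filter_upwards [h1, h2, h3] with x hx1 hx2 hx3
  rw [hx1, hx2, hx3, chirpS_apply]

omit [DecidableEq σ] in
/-- `chirpS b` lifts to the unitary `chirpL2 b` (T11 `LiftsTo`). [cite: Folland1989, (4.25)] -/
theorem liftsTo_chirpS (b : (σ → ℝ) →ₗ[ℝ] (σ → ℝ)) :
    LiftsTo (chirpS b : (SR σ) →ₗ[ℂ] SR σ) ((chirpL2 b).toContinuousLinearEquiv : (L2R σ) →L[ℂ] L2R σ) :=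
  fun f => toL2_chirpS b f

end Levi

/-! ## 7. The unitary `L²` lift of the Levi dilations (Jacobian `|det a|`) -/

section LeviL2

variable (a : (σ → ℝ) ≃ₗ[ℝ] (σ → ℝ))

omit [DecidableEq σ] in
/-- `a⁻¹` is measurable. [folklore] -/
theorem measurable_leviSymm : Measurable (a.symm : (σ → ℝ) → (σ → ℝ)) :=
  a.symm.toContinuousLinearEquiv.continuous.measurable

omit [DecidableEq σ] in
/-- **Jacobian**: `(a⁻¹)_* dx = |det a| · dx`. [folklore] -/
theorem map_leviSymm_volume :
    Measure.map (a.symm : (σ → ℝ) → (σ → ℝ)) volume =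
      ENNReal.ofReal |LinearMap.det (a : (σ → ℝ) →ₗ[ℝ] (σ → ℝ))| • (volume : Measure (σ → ℝ)) := by
  have h := Real.map_linearMap_volume_pi_eq_smul_volume_pi
    (f := (a.symm : (σ → ℝ) →ₗ[ℝ] (σ → ℝ))) (LinearEquiv.isUnit_det' a.symm).ne_zero
  rw [LinearEquiv.det_coe_symm, inv_inv] at h
  exact h

omit [DecidableEq σ] in
/-- `a⁻¹` is quasi-measure-preserving for Lebesgue measure. [folklore] -/
theorem quasiMeasurePreserving_leviSymm :
    Measure.QuasiMeasurePreserving (a.symm : (σ → ℝ) → (σ → ℝ)) volume volume :=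
  ⟨measurable_leviSymm a, by rw [map_leviSymm_volume]; exact Measure.smul_absolutelyContinuous⟩

omit [DecidableEq σ] in
/-- `|det a|^{-1/2} · g ∘ a⁻¹ ∈ L²` for `g ∈ L²`. [folklore] -/
theorem memLp_levi (g : L2R σ) :
    MemLp (fun x => leviFactor a * g (a.symm x)) 2 (volume : Measure (σ → ℝ)) := by
  have h1 : MemLp (g : (σ → ℝ) → ℂ) 2 (Measure.map (a.symm : (σ → ℝ) → (σ → ℝ)) volume) := by
    rw [map_leviSymm_volume]
    exact (Lp.memLp g).smul_measure ENNReal.ofReal_ne_top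
  exact (h1.comp_of_map (measurable_leviSymm a).aemeasurable).const_mul (leviFactor a)

/-- The Levi dilation as a linear map of `L²(ℝ^σ)`. [cite: Folland1989, (4.24)] -/
def leviL2ₗ : (L2R σ) →ₗ[ℂ] L2R σ where
  toFun g := (memLp_levi a g).toLp _
  map_add' g g' := by
    rw [← MemLp.toLp_add (memLp_levi a g) (memLp_levi a g')]
    refine MemLp.toLp_congr _ _ ?_
    filter_upwards [(quasiMeasurePreserving_leviSymm a).ae_eq_comp (Lp.coeFn_add g g')] with x hx
    rw [Pi.add_apply]
    show leviFactor a * (⇑(g + g') ∘ ⇑a.symm) x = _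
    rw [hx, Function.comp_apply, Pi.add_apply, mul_add]
  map_smul' c g := by
    rw [RingHom.id_apply, ← MemLp.toLp_const_smul c (memLp_levi a g)]
    refine MemLp.toLp_congr _ _ ?_
    filter_upwards [(quasiMeasurePreserving_leviSymm a).ae_eq_comp (Lp.coeFn_smul c g)] with x hx
    rw [Pi.smul_apply, smul_eq_mul]
    show leviFactor a * (⇑(c • g) ∘ ⇑a.symm) x = _
    rw [hx, Function.comp_apply, Pi.smul_apply, smul_eq_mul, mul_left_comm]

omit [DecidableEq σ] in
/-- `(leviL2ₗ a g)(x) = |det a|^{-1/2} g (a⁻¹ x)` a.e. [cite: Folland1989, (4.24)] -/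
theorem leviL2ₗ_coeFn (g : L2R σ) : ⇑(leviL2ₗ a g) =ᵐ[volume] fun x => leviFactor a * g (a.symm x) :=
  MemLp.coeFn_toLp (memLp_levi a g)

omit [Fintype σ] [DecidableEq σ] in
/-- `‖|det a|^{-1/2}‖ₑ · |det a|^{1/2} = 1` in `ℝ≥0∞`. [folklore] -/
theorem enorm_leviFactor_mul :
    ‖leviFactor a‖ₑ * ENNReal.ofReal |LinearMap.det (a : (σ → ℝ) →ₗ[ℝ] (σ → ℝ))| ^ (1 / 2 : ℝ) = 1 := by
  have hpos : 0 < |LinearMap.det (a : (σ → ℝ) →ₗ[ℝ] (σ → ℝ))| := abs_pos.2 (LinearEquiv.isUnit_det' a).ne_zero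
  rw [← ofReal_norm, leviFactor, Complex.norm_of_nonneg (Real.rpow_nonneg hpos.le _),
    ENNReal.ofReal_rpow_of_pos hpos, ← ENNReal.ofReal_mul (Real.rpow_nonneg hpos.le _), ← Real.rpow_add hpos]
  norm_num

omit [DecidableEq σ] in
/-- **The normalised dilation preserves the `L²` norm.** [cite: Folland1989, (4.24)] -/
theorem norm_leviL2ₗ (g : L2R σ) : ‖leviL2ₗ a g‖ = ‖g‖ := by
  rw [Lp.norm_def, Lp.norm_def, eLpNorm_congr_ae (leviL2ₗ_coeFn a g)]
  congr 1
  have h1 : (fun x => leviFactor a * g (a.symm x)) = leviFactor a • ((g : (σ → ℝ) → ℂ) ∘ (a.symm : (σ → ℝ) → (σ → ℝ))) := rfl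
  have hg : AEStronglyMeasurable (g : (σ → ℝ) → ℂ) (Measure.map (a.symm : (σ → ℝ) → (σ → ℝ)) volume) := by
    rw [map_leviSymm_volume]
    exact (Lp.aestronglyMeasurable g).smul_measure _
  rw [h1, eLpNorm_const_smul, ← eLpNorm_map_measure hg (measurable_leviSymm a).aemeasurable, map_leviSymm_volume,
    eLpNorm_smul_measure_of_ne_top ENNReal.ofNat_ne_top, smul_eq_mul, ← mul_assoc]
  have h2 : (1 / (2 : ℝ≥0∞)).toReal = (1 / 2 : ℝ) := by
    rw [one_div, ENNReal.toReal_inv, ENNReal.toReal_ofNat, one_div]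
  rw [h2, enorm_leviFactor_mul, one_mul]

omit [DecidableEq σ] in
/-- Composition law a.e.: `leviL2ₗ a (leviL2ₗ a' g) = leviL2ₗ (a a') g`. [folklore] -/
theorem leviL2ₗ_leviL2ₗ (a' : (σ → ℝ) ≃ₗ[ℝ] (σ → ℝ)) (g : L2R σ) :
    leviL2ₗ a (leviL2ₗ a' g) = leviL2ₗ (a * a') g := by
  refine Lp.ext ?_
  filter_upwards [leviL2ₗ_coeFn a (leviL2ₗ a' g), leviL2ₗ_coeFn (a * a') g,
    (quasiMeasurePreserving_leviSymm a).ae_eq_comp (leviL2ₗ_coeFn a' g)] with x hx hx' hx''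
  rw [hx, hx', leviFactor_mul, mul_assoc]
  show leviFactor a * (⇑(leviL2ₗ a' g) ∘ ⇑a.symm) x = _
  rw [hx'']
  rfl

omit [DecidableEq σ] in
/-- `leviL2ₗ 1 = id`. [folklore] -/
theorem leviL2ₗ_one (g : L2R σ) : leviL2ₗ (1 : (σ → ℝ) ≃ₗ[ℝ] (σ → ℝ)) g = g := by
  refine Lp.ext ?_
  filter_upwards [leviL2ₗ_coeFn (1 : (σ → ℝ) ≃ₗ[ℝ] (σ → ℝ)) g] with x hx
  rw [hx, leviFactor_one, one_mul]
  rfl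

/-- **The unitary Levi dilation `g ↦ |det a|^{-1/2} g ∘ a⁻¹` of `L²(ℝ^σ)`** (Folland (4.24)). [cite: Folland1989, (4.24)] -/
def leviL2 : (L2R σ) ≃ₗᵢ[ℂ] L2R σ where
  toLinearEquiv :=
    LinearEquiv.ofLinear (leviL2ₗ a) (leviL2ₗ a⁻¹)
      (LinearMap.ext fun g => by
        show leviL2ₗ a (leviL2ₗ a⁻¹ g) = g
        rw [leviL2ₗ_leviL2ₗ, mul_inv_cancel, leviL2ₗ_one])
      (LinearMap.ext fun g => by
        show leviL2ₗ a⁻¹ (leviL2ₗ a g) = g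
        rw [leviL2ₗ_leviL2ₗ, inv_mul_cancel, leviL2ₗ_one])
  norm_map' := norm_leviL2ₗ a

omit [DecidableEq σ] in
/-- Unfolding. [folklore] -/
@[simp] theorem leviL2_apply (g : L2R σ) : leviL2 a g = leviL2ₗ a g := rfl

omit [DecidableEq σ] in
/-- `(leviL2 a g)(x) = |det a|^{-1/2} g (a⁻¹ x)` a.e. [cite: Folland1989, (4.24)] -/
theorem leviL2_coeFn (g : L2R σ) : ⇑(leviL2 a g) =ᵐ[volume] fun x => leviFactor a * g (a.symm x) :=
  leviL2ₗ_coeFn a g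

omit [DecidableEq σ] in
/-- **The Schwartz dilation is the `L²` dilation on the dense subspace**: `toL2 (leviS a f) = leviL2 a (toL2 f)`.
[cite: Folland1989, (4.24)] -/
theorem toL2_leviS (f : SR σ) : toL2 (leviS a f) = leviL2 a (toL2 f) := by
  apply Lp.ext
  filter_upwards [coeFn_toL2 (leviS a f), leviL2_coeFn a (toL2 f),
    (quasiMeasurePreserving_leviSymm a).ae_eq_comp (coeFn_toL2 f)] with x hx1 hx2 hx3
  rw [hx1, hx2, leviS_apply]
  show _ = leviFactor a * ((toL2 f : (σ → ℝ) → ℂ) ∘ ⇑a.symm) x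
  rw [hx3]
  rfl

omit [DecidableEq σ] in
/-- `leviS a` lifts to the unitary `leviL2 a` (T11 `LiftsTo`). [cite: Folland1989, (4.24)] -/
theorem liftsTo_leviS :
    LiftsTo (leviS a : (SR σ) →ₗ[ℂ] SR σ) ((leviL2 a).toContinuousLinearEquiv : (L2R σ) →L[ℂ] L2R σ) :=
  fun f => toL2_leviS a f

end LeviL2

end Literature.Analysis.SegalBargmann
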